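import Summits.AtomisticToContinuum.Crystallization.Theorems.FrustratedLawDichotomyStrainedPatchPhaseExclusive
import Summits.AtomisticToContinuum.Crystallization.Theorems.FrustratedLawDichotomyStrainedPatchQuantSlavingA
import HarnessLib

/-!
# Phase exclusivity AT THE PHASE-AWARE TABLES: the hcp rows addressed by an hcp hypothesis (hand-2 g36, structural share for
`stmt-AtomisticToContinuum-27623`; sequel of `…StrainedPatchPhaseExclusive`, critic rows 1348 (1)(2) / 1353 (B))

The T-side's phase-aware tables are `if FccGoodAtScale (1/8) (3/2) z₀ c₀ then (fcc row) else (hcp row)`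
(`…ChartFamiliesPinned.levelTable`, `…EnvelopeLaw.levelTableShift`, the E-side glue `…QuantSlaving.splitTable 𝓟 Φ₁ Φ₂`; row 1348 (1)
made this FAMILY SPLIT the default table shape).  Until now the `else` row could only be reached from the NEGATIVE hypothesis
`¬FccGoodAtScale …` (e.g. `…ChartFamiliesPinned.Phi0_hcp`), which an hcp-class host does not supply by itself; row 1348 (2) booked the missing
step as «C-excl-1/8».  With `…PhaseExclusive.not_fccGoodAtScale_of_hcpGoodAtScale` in the tree (p853160) the hcp rows are addressed
BY THE POSITIVE hcp HYPOTHESIS: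

* §1 (general) `ite_fcc_eq_else_of_hcpGoodAtScale` — any phase-split `ite` (any type, any `Decidable` instance) at an hcp-good site takes
  its `else` branch; `hcpGoodAtScale_iff_not_fcc_of_goodAtScale` — on a clean site (`GoodAtScale (1/8) (3/2)`) "hcp-good" IS "not fcc-good".
* §2 (specialised to the tables of record) `levelTable_of_hcpGoodAtScale`, `levelTableShift_of_hcpGoodAtScale`, `Phi0_of_hcpGoodAtScale`
  (= `Phi0_hcp` by name), `splitTable_fcc_of_hcpGoodAtScale` (the E-side glued table prices an hcp host at its off-class table `Φ₂`).

DEF-FREE; imports only the tree (`…PhaseExclusive`, `…QuantSlavingA`); 0 sorry; standard axioms.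
-/

noncomputable section

open scoped BigOperators Classical

namespace Summit.AtomisticToContinuum.Crystallization.Theorems.FrustratedLawDichotomyStrainedPatchPhaseExclusive

open Summit.AtomisticToContinuum.Crystallization.Theorems.FrustratedLawDichotomyAveragingCut (E3)
open Summit.AtomisticToContinuum.Crystallization.Theorems.FrustratedLawDichotomyMotifLemmas (GoodAtScale)
open Summit.AtomisticToContinuum.Crystallization.Theorems.FrustratedLawDichotomyStrainedPatchPhaseCut
  (FccGoodAtScale HcpGoodAtScale goodAtScale_iff_fcc_or_hcp)
open Summit.AtomisticToContinuum.Crystallization.Theorems.FrustratedLawDichotomyStrainedPatchStrainBands (fitLevel windowRoom)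
open Summit.AtomisticToContinuum.Crystallization.Theorems.FrustratedLawDichotomyStrainedPatchHomSplit (sigmaOne)
open Summit.AtomisticToContinuum.Crystallization.Theorems.FrustratedLawDichotomyStrainedPatchChartFamiliesPinned (levelTable Phi0 Phi0_hcp)
open Summit.AtomisticToContinuum.Crystallization.Theorems.FrustratedLawDichotomyStrainedPatchEnvelopeLaw (levelTableShift)
open Summit.AtomisticToContinuum.Crystallization.Theorems.FrustratedLawDichotomyStrainedPatchQuantSlaving (ChartFam ModTab splitTable)

/-! ## §1. General: phase-split conditionals at an hcp-good site; hcp-good ↔ not fcc-good on clean sites -/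

/-- ★★ **A phase-split conditional at an hcp-good site takes its `else` branch** (any type, any decidability instance). [this file] -/
theorem ite_fcc_eq_else_of_hcpGoodAtScale {α : Sort*} {M : ℕ} {z : Fin M → E3} {c : Fin M}
    (h : HcpGoodAtScale (1 / 8) (3 / 2) z c) [Decidable (FccGoodAtScale (1 / 8) (3 / 2) z c)] (a b : α) :
    (if FccGoodAtScale (1 / 8) (3 / 2) z c then a else b) = b :=
  if_neg (not_fccGoodAtScale_of_hcpGoodAtScale h)

/-- ★★ **On a clean site, hcp-good IS not-fcc-good**: under `GoodAtScale (1/8) (3/2) z c` (= fcc-good ∨ hcp-good),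
`HcpGoodAtScale (1/8) (3/2) z c ↔ ¬ FccGoodAtScale (1/8) (3/2) z c`. [this file] -/
theorem hcpGoodAtScale_iff_not_fcc_of_goodAtScale {M : ℕ} {z : Fin M → E3} {c : Fin M} (hg : GoodAtScale (1 / 8) (3 / 2) z c) :
    HcpGoodAtScale (1 / 8) (3 / 2) z c ↔ ¬ FccGoodAtScale (1 / 8) (3 / 2) z c :=
  ⟨not_fccGoodAtScale_of_hcpGoodAtScale, fun hn => (goodAtScale_iff_fcc_or_hcp.1 hg).resolve_left hn⟩

/-- ★★ Dually, on a clean site `FccGoodAtScale (1/8) (3/2) z c ↔ ¬ HcpGoodAtScale (1/8) (3/2) z c`. [this file] -/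
theorem fccGoodAtScale_iff_not_hcp_of_goodAtScale {M : ℕ} {z : Fin M → E3} {c : Fin M} (hg : GoodAtScale (1 / 8) (3 / 2) z c) :
    FccGoodAtScale (1 / 8) (3 / 2) z c ↔ ¬ HcpGoodAtScale (1 / 8) (3 / 2) z c :=
  ⟨not_hcpGoodAtScale_of_fccGoodAtScale, fun hn => (goodAtScale_iff_fcc_or_hcp.1 hg).resolve_right hn⟩

/-! ## §2. Specialised: the hcp rows of the tables of record, by the positive hcp hypothesis -/

/-- ★ **The phase-aware level table at an hcp-good instance reads its hcp row**:
`levelTable af bf cf ah bh ch M₀ z₀ c₀ = ah + bh·x + ch·x²`, `x = fitLevel z₀ c₀ − 1/20`. [this file] -/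
theorem levelTable_of_hcpGoodAtScale (af bf cf ah bh ch : ℝ) {M₀ : ℕ} {z₀ : Fin M₀ → E3} {c₀ : Fin M₀}
    (h : HcpGoodAtScale (1 / 8) (3 / 2) z₀ c₀) :
    levelTable af bf cf ah bh ch M₀ z₀ c₀ =
      ah + bh * (fitLevel z₀ c₀ - 1 / 20) + ch * (fitLevel z₀ c₀ - 1 / 20) ^ 2 := by
  simp only [levelTable, if_neg (not_fccGoodAtScale_of_hcpGoodAtScale h)]

/-- The fcc row, for symmetry (`if_pos`). [formal bookkeeping] -/
theorem levelTable_of_fccGoodAtScale (af bf cf ah bh ch : ℝ) {M₀ : ℕ} {z₀ : Fin M₀ → E3} {c₀ : Fin M₀}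
    (h : FccGoodAtScale (1 / 8) (3 / 2) z₀ c₀) :
    levelTable af bf cf ah bh ch M₀ z₀ c₀ =
      af + bf * (fitLevel z₀ c₀ - 1 / 20) + cf * (fitLevel z₀ c₀ - 1 / 20) ^ 2 := by
  simp only [levelTable, if_pos h]

/-- ★ **The shifted level table at an hcp-good instance reads its hcp row** (`x + s` in place of `x`). [this file] -/
theorem levelTableShift_of_hcpGoodAtScale (af bf cf ah bh ch : ℝ) {M₀ : ℕ} {z₀ : Fin M₀ → E3} {c₀ : Fin M₀}
    (h : HcpGoodAtScale (1 / 8) (3 / 2) z₀ c₀) (s : ℝ) :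
    levelTableShift af bf cf ah bh ch M₀ z₀ c₀ s =
      ah + bh * (fitLevel z₀ c₀ - 1 / 20 + s) + ch * (fitLevel z₀ c₀ - 1 / 20 + s) ^ 2 := by
  simp only [levelTableShift, if_neg (not_fccGoodAtScale_of_hcpGoodAtScale h)]

/-- The fcc row of the shifted table (`if_pos`). [formal bookkeeping] -/
theorem levelTableShift_of_fccGoodAtScale (af bf cf ah bh ch : ℝ) {M₀ : ℕ} {z₀ : Fin M₀ → E3} {c₀ : Fin M₀}
    (h : FccGoodAtScale (1 / 8) (3 / 2) z₀ c₀) (s : ℝ) :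
    levelTableShift af bf cf ah bh ch M₀ z₀ c₀ s =
      af + bf * (fitLevel z₀ c₀ - 1 / 20 + s) + cf * (fitLevel z₀ c₀ - 1 / 20 + s) ^ 2 := by
  simp only [levelTableShift, if_pos h]

/-- ★ **The modulus of record `Φ₀` at an hcp-good instance** — `…ChartFamiliesPinned.Phi0_hcp` (which asks for `¬FccGoodAtScale`) reached from
the positive hcp hypothesis. [this file] -/
theorem Phi0_of_hcpGoodAtScale {M₀ : ℕ} {z₀ : Fin M₀ → E3} {c₀ : Fin M₀} (h : HcpGoodAtScale (1 / 8) (3 / 2) z₀ c₀) (t : ℝ) :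
    Phi0 M₀ z₀ c₀ t = (93 / 2000 + 7 / 10 * (fitLevel z₀ c₀ - 1 / 20) + 35 / 2 * (fitLevel z₀ c₀ - 1 / 20) ^ 2) * t
      + (41 / 50000 + 1 / 80 * (fitLevel z₀ c₀ - 1 / 20) + 1 / 4 * (fitLevel z₀ c₀ - 1 / 20) ^ 2) + 1 / 4 * t ^ 2
      + ((9 / 500 + 2 / 5 * (fitLevel z₀ c₀ - 1 / 20) + 7 * (fitLevel z₀ c₀ - 1 / 20) ^ 2) * (windowRoom z₀ c₀ + 3 / 10 * sigmaOne)
        + 1 / 10000) :=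
  Phi0_hcp (not_fccGoodAtScale_of_hcpGoodAtScale h) t

/-- ★ **The E-side glued table prices an hcp-good host at its OFF-class table**: with the phase class
`𝓟 := fun _ z c => FccGoodAtScale (1/8) (3/2) z c`, `splitTable 𝓟 Φ₁ Φ₂ M₀ z₀ c₀ t = Φ₂ M₀ z₀ c₀ t` at every hcp-good `(z₀, c₀)`
(row 1348 (1): the E-side may use the cheaper hcp branch there). [this file] -/
theorem splitTable_fcc_of_hcpGoodAtScale {Φ₁ Φ₂ : ModTab} {M₀ : ℕ} {z₀ : Fin M₀ → E3} {c₀ : Fin M₀}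
    (h : HcpGoodAtScale (1 / 8) (3 / 2) z₀ c₀) (t : ℝ) :
    splitTable (fun _ z c => FccGoodAtScale (1 / 8) (3 / 2) z c) Φ₁ Φ₂ M₀ z₀ c₀ t = Φ₂ M₀ z₀ c₀ t := by
  simp only [splitTable, if_neg (not_fccGoodAtScale_of_hcpGoodAtScale h)]

/-- The fcc host reads the ON-class table `Φ₁` (`if_pos`). [formal bookkeeping] -/
theorem splitTable_fcc_of_fccGoodAtScale {Φ₁ Φ₂ : ModTab} {M₀ : ℕ} {z₀ : Fin M₀ → E3} {c₀ : Fin M₀}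
    (h : FccGoodAtScale (1 / 8) (3 / 2) z₀ c₀) (t : ℝ) :
    splitTable (fun _ z c => FccGoodAtScale (1 / 8) (3 / 2) z c) Φ₁ Φ₂ M₀ z₀ c₀ t = Φ₁ M₀ z₀ c₀ t := by
  simp only [splitTable, if_pos h]

end Summit.AtomisticToContinuum.Crystallization.Theorems.FrustratedLawDichotomyStrainedPatchPhaseExclusive

end
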